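import Mathlib.Algebra.BigOperators.Group.Finset.Piecewise
import Mathlib.Algebra.Order.BigOperators.Group.Finset
import Mathlib.Data.Finset.Lattice.Fold
import Mathlib.Data.Fintype.Fin
import HarnessLib
import HarnessLib.Audit.Tags

/-!
# Purely inseparable four-folds — ISO-SPINE-PO, part I: the FROZEN-MONOMIAL LEMMA
# (no exponent trajectory of bounded degree moves for ever under chart-origin point blow-ups)
# [OURS · counted 0 · cell res-dim4-pi · idea-3's card I-3-4 (statements) · p-9 (proofs)]

Census cell «res-dim4-pi» (D-0157 DOOR 2), frame v4 TIER 1 (I) = the ISOLATED regime of the purely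
inseparable four-fold `z^p + F(x₁,…,x₄)`.  Memo HOME/res-dim4-idea-3/spine/ISO-SPINE-PO.md
(res-dim4-idea-3, 2026-08-28) reduces the SPINE half of the frame question F4-I
(`PIDim4.NoIsolatedTrap`, file `PurelyInseparableDim4Scope`) to pure exponent combinatorics and
proves it on paper; the `Prop`s of §1 are idea-3's `IsoSpineSketch.lean` VERBATIM (so that every seat
states against one text); this file PROVES the engine of the argument, the frozen-monomial lemma
(§3), after the elementary kinematics of one move (§2).  The theorem T(n,q) itself
(`NoPointOnlySpineBranch`) is the sequel `PurelyInseparableDim4IsoSpineTheorem.lean`, the frame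
corollary the file after.

THE SETTING (supports only; the spine is characteristic-free).  A state on the spine is its support,
a finite set of exponent vectors `m : Fin n → ℕ`, all of total degree `≥ q` (`Legal`).  The chart-origin
point blow-up in the chart `j` moves `m ↦ spineMove q j m` = "`m_j ← |m| − q`" (the exponent law of
`CentreBlowup.chartExponent q univ j`; [cite: HauserPerlega2019PRIMS, §2 (the blowup in the
x₁-chart)]); coefficients never interact at `b = 0`, and cleaning only deletes.  POINT-ONLY
(`PointOnly`): for every axis `k` some monomial has off-`k` degree `< q` — no proper coordinate
subspace is a permissible centre; an ISOLATED `q`-fold point is point-only.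

THE LEMMA (memo §2).  If `m(t+1) = spineMove q (j t) (m t)` for all `t`, every `m t` is legal and the
degrees `|m t|` are bounded, then `m (t+1) = m t` for all large `t`.  Proof (formalised below): playing
`j` at time `t` STAMPS `m_j := |m(t)| − q`; let `M` be the largest degree occurring infinitely often
(`exists_frequently_eq_and_eventually_le`, a finite pigeonhole); from some time on every degree is
`≤ M`, every axis still being played has been played since, so its stamp is `≤ M − q`
(`stamp_le`); at a time of degree `M` the next degree is `2M − (stamp + q) ≥ M`, hence `= M`, the stamp
was `M − q` and the move is the identity — for ever after (`frozenMonomialLemma`).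

Nothing in this file is a statement about resolution of singularities; resolution in dimension ≥ 4 /
characteristic `p` is NOT proved anywhere in this programme; counted 0; AI formalisation, weaker
than expert review.  bears_on: LADDER-RESOLUTION:D157-DOOR2 (res-dim4-pi · ISO-SPINE-PO).
Supports stmt-ResolutionOfSingularities-16155 (helper).
-/

set_option linter.dupNamespace false

namespace Summit.ResolutionOfSingularities.ResolutionOfSingularities.Theorems.PIDim4.IsoSpine

open Finset

/-! ## 1. The statements (res-dim4-idea-3, `IsoSpineSketch.lean`, verbatim) -/

/-- chart-origin exponent law of the point blow-up, chart `j`: `m_j ← |m| − q`.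
[cite: HauserPerlega2019PRIMS, §2 (the blowup in the x₁-chart)] -/
def spineMove {n : ℕ} (q : ℕ) (j : Fin n) (m : Fin n → ℕ) : Fin n → ℕ :=
  Function.update m j ((∑ i, m i) - q)

/-- every monomial has total degree `≥ q` (the state is `q`-fold; makes `|m| − q` an honest
subtraction). [folklore] -/
def Legal {n : ℕ} (q : ℕ) (A : Finset (Fin n → ℕ)) : Prop := ∀ m ∈ A, q ≤ ∑ i, m i

/-- POINT-ONLY: for every axis `k` some monomial is `k`-near (off-`k` degree `< q`); equivalently no
proper coordinate subspace `C_S` (`S ≠ univ`) has `ord_S ≥ q`.  Necessary for an isolated `q`-fold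
point. [folklore] -/
def PointOnly {n : ℕ} (q : ℕ) (A : Finset (Fin n → ℕ)) : Prop :=
  ∀ k : Fin n, ∃ m ∈ A, (∑ i, m i) - m k < q

/-- **T(n,q)**: no infinite legal point-only spine branch (sub-supports allowed at every step =
deletions). [folklore] -/
def NoPointOnlySpineBranch (n q : ℕ) : Prop :=
  ¬ ∃ (A : ℕ → Finset (Fin n → ℕ)) (j : ℕ → Fin n),
      ∀ t, Legal q (A t) ∧ PointOnly q (A t) ∧ A (t + 1) ⊆ (A t).image (spineMove q (j t))

/-- **Frozen-monomial lemma** (the engine of T): a single exponent trajectory under chart-origin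
moves with bounded total degree is eventually literally constant. [folklore] -/
def FrozenMonomialLemma (n q : ℕ) : Prop :=
  ∀ (j : ℕ → Fin n) (m : ℕ → (Fin n → ℕ)) (D : ℕ),
    (∀ t, m (t + 1) = spineMove q (j t) (m t)) → (∀ t, q ≤ ∑ i, m t i) → (∀ t, ∑ i, m t i ≤ D) →
      ∃ t₁, ∀ t, t₁ ≤ t → m (t + 1) = m t

/-! ## 2. Kinematics of one move -/

/-- The move changes only the coordinate `j`. [folklore] -/
theorem spineMove_apply_of_ne {n : ℕ} (q : ℕ) {j i : Fin n} (hij : i ≠ j) (m : Fin n → ℕ) :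
    spineMove q j m i = m i := by
  unfold spineMove
  rw [Function.update_of_ne hij]

/-- The new coordinate `j` is `|m| − q`. [folklore] -/
theorem spineMove_apply_self {n : ℕ} (q : ℕ) (j : Fin n) (m : Fin n → ℕ) :
    spineMove q j m j = (∑ i, m i) - q := by
  unfold spineMove
  rw [Function.update_self]

/-- A coordinate is at most the total degree. [folklore] -/
theorem apply_le_sum {n : ℕ} (m : Fin n → ℕ) (k : Fin n) : m k ≤ ∑ i, m i :=
  Finset.single_le_sum (f := m) (fun i _ => Nat.zero_le (m i)) (Finset.mem_univ k)

/-- **Degree law**: `|spineMove q j m| + (m_j + q) = 2|m|` for a legal monomial — the new degree is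
`2|m| − (stamp of j)`, the stamp being `m_j + q`. [folklore] -/
theorem sum_spineMove_add {n : ℕ} (q : ℕ) (j : Fin n) (m : Fin n → ℕ) (hq : q ≤ ∑ i, m i) :
    (∑ i, spineMove q j m i) + (m j + q) = 2 * ∑ i, m i := by
  unfold spineMove
  rw [Finset.sum_update_of_mem (Finset.mem_univ j), Finset.sdiff_singleton_eq_erase]
  have h := Finset.add_sum_erase Finset.univ m (Finset.mem_univ j)
  have hj := apply_le_sum m j
  omega

/-- The off-`j` degree is unchanged by the move in the chart `j`. [folklore] -/
theorem sum_spineMove_sub_self {n : ℕ} (q : ℕ) (j : Fin n) (m : Fin n → ℕ) (hq : q ≤ ∑ i, m i) :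
    (∑ i, spineMove q j m i) - spineMove q j m j = (∑ i, m i) - m j := by
  have h := sum_spineMove_add q j m hq
  rw [spineMove_apply_self]
  omega

/-- The move is the identity iff the stamp `m_j + q` equals the degree. [folklore] -/
theorem spineMove_eq_self_iff {n : ℕ} (q : ℕ) (j : Fin n) (m : Fin n → ℕ) (hq : q ≤ ∑ i, m i) :
    spineMove q j m = m ↔ m j + q = ∑ i, m i := by
  unfold spineMove
  rw [Function.update_eq_self_iff]
  omega

/-- A `j`-NEAR monomial (off-`j` degree `< q`) strictly LOSES degree under the move in the chart `j`;
in particular it is not fixed. [folklore] -/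
theorem sum_spineMove_lt_of_near {n : ℕ} (q : ℕ) (j : Fin n) (m : Fin n → ℕ) (hq : q ≤ ∑ i, m i)
    (hnear : (∑ i, m i) - m j < q) : ∑ i, spineMove q j m i < ∑ i, m i := by
  have h := sum_spineMove_add q j m hq
  omega

/-- **The move is injective on legal monomials** (so supports never merge on the spine). [folklore] -/
theorem spineMove_injective_of_legal {n : ℕ} (q : ℕ) (j : Fin n) {m m' : Fin n → ℕ}
    (hq : q ≤ ∑ i, m i) (hq' : q ≤ ∑ i, m' i) (h : spineMove q j m = spineMove q j m') : m = m' := by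
  have hne : ∀ i, i ≠ j → m i = m' i := fun i hi => by
    have := congr_fun h i
    rwa [spineMove_apply_of_ne q hi, spineMove_apply_of_ne q hi] at this
  have hjj := congr_fun h j
  rw [spineMove_apply_self, spineMove_apply_self] at hjj
  have hdeg : ∑ i, m i = ∑ i, m' i := by omega
  have he : ∑ i ∈ Finset.univ.erase j, m i = ∑ i ∈ Finset.univ.erase j, m' i :=
    Finset.sum_congr rfl fun i hi => hne i (Finset.ne_of_mem_erase hi)
  have h1 := Finset.add_sum_erase Finset.univ m (Finset.mem_univ j)
  have h2 := Finset.add_sum_erase Finset.univ m' (Finset.mem_univ j)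
  funext i
  by_cases hi : i = j
  · subst hi; omega
  · exact hne i hi

/-! ## 3. The frozen-monomial lemma -/

/-- **Finite pigeonhole, «limsup» form**: a sequence of naturals bounded by `D` has a value `M` that
it takes beyond every time AND that bounds it from some time on. [folklore] -/
theorem exists_frequently_eq_and_eventually_le (f : ℕ → ℕ) (D : ℕ) (hf : ∀ t, f t ≤ D) :
    ∃ M, (∀ N, ∃ t, N ≤ t ∧ f t = M) ∧ ∃ N₁, ∀ t, N₁ ≤ t → f t ≤ M := by
  induction D generalizing f with
  | zero => exact ⟨0, fun N => ⟨N, le_rfl, Nat.le_zero.mp (hf N)⟩, 0, fun t _ => hf t⟩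
  | succ D ih =>
    by_cases hio : ∀ N, ∃ t, N ≤ t ∧ f t = D + 1
    · exact ⟨D + 1, hio, 0, fun t _ => hf t⟩
    · push Not at hio
      obtain ⟨N₀, hN₀⟩ := hio
      have hg : ∀ t, f (t + N₀) ≤ D := fun t => by
        have h1 := hf (t + N₀)
        have h2 := hN₀ (t + N₀) (Nat.le_add_left _ _)
        omega
      obtain ⟨M, hM, N₁, hN₁⟩ := ih (fun t => f (t + N₀)) hg
      refine ⟨M, fun N => ?_, N₁ + N₀, fun t ht => ?_⟩
      · obtain ⟨t, hNt, hft⟩ := hM N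
        exact ⟨t + N₀, le_trans hNt (Nat.le_add_right _ _), hft⟩
      · have h := hN₁ (t - N₀) (by omega)
        have ht' : t - N₀ + N₀ = t := Nat.sub_add_cancel (by omega)
        rw [ht'] at h
        exact h

/-- **Stamp bookkeeping**: if from time `N₁` on every degree is `≤ M`, then at every later time `t`
every axis `i` played at some time `t' ∈ [N₁, t)` carries `m_i(t) + q ≤ M` (its coordinate was stamped
with a degree `≤ M` at its last play and has not moved since). [folklore] -/
theorem stamp_le {n : ℕ} (q : ℕ) (j : ℕ → Fin n) (m : ℕ → (Fin n → ℕ))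
    (hrec : ∀ t, m (t + 1) = spineMove q (j t) (m t)) (hlegal : ∀ t, q ≤ ∑ i, m t i) {N₁ M : ℕ}
    (hle : ∀ t, N₁ ≤ t → ∑ i, m t i ≤ M) :
    ∀ t, N₁ ≤ t → ∀ i, (∃ t', N₁ ≤ t' ∧ t' < t ∧ j t' = i) → m t i + q ≤ M := by
  intro t ht
  induction t, ht using Nat.le_induction with
  | base =>
    rintro i ⟨t', h1, h2, -⟩
    omega
  | succ t ht ih =>
    rintro i ⟨t', h1, h2, h3⟩
    rw [hrec t]
    by_cases hij : i = j t
    · subst hij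
      rw [spineMove_apply_self]
      have h4 := hle t ht
      have h5 := hlegal t
      omega
    · rw [spineMove_apply_of_ne q hij]
      have hcases : t' < t ∨ t' = t := by omega
      rcases hcases with h | h
      · exact ih i ⟨t', h1, h, h3⟩
      · subst h
        exact absurd h3.symm hij

/-- **THE FROZEN-MONOMIAL LEMMA** (memo ISO-SPINE-PO §2, res-dim4-idea-3; every `n`, `q`): an exponent
trajectory under chart-origin moves, legal and of bounded degree, is eventually literally constant.
Equivalently: a single exponent vector is never periodic under chart-origin moves unless fixed.
[folklore] -/
theorem frozenMonomialLemma (n q : ℕ) : FrozenMonomialLemma n q := by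
  intro j m D hrec hlegal hbound
  -- the largest degree occurring infinitely often, and a time after which it bounds every degree
  obtain ⟨M, hio', N₁, hle'⟩ :=
    exists_frequently_eq_and_eventually_le (fun t => ∑ i, m t i) D hbound
  have hio : ∀ N, ∃ t, N ≤ t ∧ ∑ i, m t i = M := hio'
  have hle : ∀ t, N₁ ≤ t → ∑ i, m t i ≤ M := hle'
  -- axes played only finitely often: a time after which they are never played
  have hfin : ∀ i : Fin n, ∃ Ni : ℕ, (∃ N, ∀ t, N ≤ t → j t ≠ i) → ∀ t, Ni ≤ t → j t ≠ i := by
    intro i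
    by_cases h : ∃ N, ∀ t, N ≤ t → j t ≠ i
    · obtain ⟨N, hN⟩ := h
      exact ⟨N, fun _ => hN⟩
    · exact ⟨0, fun h' => (h h').elim⟩
  choose Nf hNf using hfin
  -- axes played infinitely often: a play after `t₀ = max N₁ (sup Nf)`
  have hinf : ∀ i : Fin n, ∃ Pi : ℕ,
      (∀ N, ∃ t, N ≤ t ∧ j t = i) → max N₁ (Finset.univ.sup Nf) ≤ Pi ∧ j Pi = i := by
    intro i
    by_cases h : ∀ N, ∃ t, N ≤ t ∧ j t = i
    · obtain ⟨t, ht, hjt⟩ := h (max N₁ (Finset.univ.sup Nf))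
      exact ⟨t, fun _ => ⟨ht, hjt⟩⟩
    · exact ⟨0, fun h' => (h h').elim⟩
  choose P hP using hinf
  -- a time of degree `M` after all of that
  obtain ⟨tstar, htstar, hdstar⟩ := hio (max (Finset.univ.sup P + 1) (max N₁ (Finset.univ.sup Nf)))
  have hstamp := stamp_le q j m hrec hlegal hle
  -- one step at degree `M` beyond `tstar` is the identity and keeps the degree
  have hstep : ∀ t, tstar ≤ t → ∑ i, m t i = M → (∑ i, m (t + 1) i = M) ∧ m (t + 1) = m t := by
    intro t ht hdt
    -- the played axis is played infinitely often
    have hainf : ∀ N, ∃ t', N ≤ t' ∧ j t' = j t := by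
      by_contra h
      push Not at h
      have h1 : Nf (j t) ≤ Finset.univ.sup Nf := Finset.le_sup (f := Nf) (Finset.mem_univ (j t))
      have h2 : Finset.univ.sup Nf ≤ t := by omega
      exact hNf (j t) h t (le_trans h1 h2) rfl
    obtain ⟨hPa1, hPa2⟩ := hP (j t) hainf
    have hP1 : P (j t) ≤ Finset.univ.sup P := Finset.le_sup (f := P) (Finset.mem_univ (j t))
    have hI := hstamp t (by omega) (j t) ⟨P (j t), by omega, by omega, hPa2⟩
    have hd1 := sum_spineMove_add q (j t) (m t) (hlegal t)
    rw [← hrec t] at hd1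
    have hle1 := hle (t + 1) (by omega)
    refine ⟨by omega, ?_⟩
    rw [hrec t, spineMove_eq_self_iff q (j t) (m t) (hlegal t)]
    omega
  -- hence the degree is `M` for ever after `tstar`, and every later step is the identity
  have hdM : ∀ t, tstar ≤ t → ∑ i, m t i = M := by
    intro t ht
    induction t, ht using Nat.le_induction with
    | base => exact hdstar
    | succ t ht ih => exact (hstep t ht ih).1
  exact ⟨tstar, fun t ht => (hstep t ht (hdM t ht)).2⟩

end Summit.ResolutionOfSingularities.ResolutionOfSingularities.Theorems.PIDim4.IsoSpine
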